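import Mathlib
import Literature.Analysis.FluidPDE.Tao2016AveragedNS.RestartedCascadeFlows
import Literature.Analysis.FluidPDE.Tao2016AveragedNS.ShiftSetCascadeFlows
import Summits.NavierStokesRegularity.NavierStokesRegularity.Theorems.TaoLadderRungTwoBreakDSSWaveOfQuadTermDatum
import HarnessLib

/-!
# One-shift datum as a zero-defect PSEUDO-FLOW (`PseudoFlowOn … 0 κ₂ …`, the tree's exact-flow
# packaging, as produced by p1's `WeightedLatticeFlowsOn` existence theory) ⟹ admissible DSS wave
# (cell harvest/h2-tao-ladder, seat p2; support for K1(1) = `NoSurvivingDSSOne`, stmt-NavierStokesRegularity-20205)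

MODEL lattice ODEs only (Tao 2016 §4); nothing about the Navier–Stokes equations; no item closed.

`DSSOneShift.isDSSWave_of_quadTermDatum` wants `HasDerivWithinAt (X i k) (quadTerm ε₀ α X i k s) (Icc 0 τ) s`.
The tree's flow objects record the motion law as `|derivWithin (S i k) (Icc 0 τ) s − quadTerm …| ≤ κ₁ (…)`
together with `ContDiffOn ℝ 1 (S i k) (Icc 0 τ)`. At defect `κ₁ = 0` the two coincide
(`hasDerivWithinAt_quadTerm_of_pseudoFlowOn`, and the `𝕊 = S` twin via `quadTermOn_shiftSet`), which
gives the end-to-end statements `isDSSWave_of_pseudoFlowOnDatum` / `exists_surviving_dssWave_of_pseudoFlowOnDatum`: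
an EXACT pseudo-flow of the table on the closed flight `[0, τ]` whose end state is the `g⁻¹`-rescaled
shift of its start state (`g S_{i,k+1}(τ) = S₀_{i,k}`), with `Λ = g e^{T}` and the shell bounds of the
dictionary, carries a (non-trivial, surviving) admissible DSS wave. So the remaining non-kernel link of
p2's STAGE 2 reads, in tree vocabulary: «certificate ⟹ ∃ exact `PseudoFlowOn τ ε₀ α 0 0 S₀ (½S₀²) 0 S (½S²)`
with the one-shift end condition and the wake/top bounds».
-/

noncomputable section

-- `Summit.NavierStokesRegularity.NavierStokesRegularity.…` is the tree's (summit = problem) namespace; the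
-- duplicated component is intended, so the dupNamespace linter is silenced for this file.
set_option linter.dupNamespace false

namespace Summit.NavierStokesRegularity.NavierStokesRegularity.Theorems

namespace DSSOneShift

open Filter Topology MeasureTheory Set
open Literature.Analysis.FluidPDE Literature.Analysis.FluidPDE.TaoCascade

variable {m : ℕ}

/-- A ZERO-DEFECT pseudo-flow is an exact solution with one-sided derivatives on the closed flight:
`HasDerivWithinAt (S i k) (quadTerm ε₀ α S i k s) (Icc 0 τ) s`. [cite: Tao2016AveragedNS, §4 Lemma 4.1 (4.8); cell vocabulary (`PseudoFlowOn`)] -/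
theorem hasDerivWithinAt_quadTerm_of_pseudoFlowOn {τ ε₀ κ₂ : ℝ}
    {α : Fin m → Fin m → Fin m → ℤ × ℤ × ℤ → ℝ} {S₀ F₀ B₀ : Fin m → ℤ → ℝ}
    {S F : Fin m → ℤ → ℝ → ℝ} (h : PseudoFlowOn τ ε₀ α 0 κ₂ S₀ F₀ B₀ S F)
    (i : Fin m) (k : ℤ) {s : ℝ} (hs : s ∈ Icc 0 τ) :
    HasDerivWithinAt (S i k) (quadTerm ε₀ α S i k s) (Icc 0 τ) s := by
  have hd : DifferentiableWithinAt ℝ (S i k) (Icc 0 τ) s :=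
    ((h.contDiffOn_S i k).differentiableOn one_ne_zero) s hs
  have hm := h.motion i k s hs
  rw [zero_mul, zero_mul, abs_nonpos_iff, sub_eq_zero] at hm
  rw [← hm]
  exact hd.hasDerivWithinAt

/-- The same for a zero-defect pseudo-flow on the parameter `𝕊 = S` (`PseudoFlowOnShift shiftSet`).
[cite: Tao2016AveragedNS, §4 Lemma 4.1 (4.8); cell vocabulary, shift-set parametrised] -/
theorem hasDerivWithinAt_quadTerm_of_pseudoFlowOnShift {τ ε₀ κ₂ : ℝ}
    {α : Fin m → Fin m → Fin m → ℤ × ℤ × ℤ → ℝ} {S₀ F₀ B₀ : Fin m → ℤ → ℝ}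
    {S F : Fin m → ℤ → ℝ → ℝ} (h : PseudoFlowOnShift shiftSet τ ε₀ α 0 κ₂ S₀ F₀ B₀ S F)
    (i : Fin m) (k : ℤ) {s : ℝ} (hs : s ∈ Icc 0 τ) :
    HasDerivWithinAt (S i k) (quadTerm ε₀ α S i k s) (Icc 0 τ) s := by
  have hd : DifferentiableWithinAt ℝ (S i k) (Icc 0 τ) s :=
    ((h.contDiffOn_S i k).differentiableOn one_ne_zero) s hs
  have hm := h.motion i k s hs
  rw [zero_mul, zero_mul, abs_nonpos_iff, sub_eq_zero, quadTermOn_shiftSet] at hm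
  rw [← hm]
  exact hd.hasDerivWithinAt

/-- **Exact pseudo-flow with the one-shift end condition ⟹ admissible DSS wave.**  Let
`PseudoFlowOn τ ε₀ α 0 κ₂ S₀ F₀ B₀ S F` be a ZERO-DEFECT flow of the table on `[0, τ]` whose end state is
the rescaled shift of its start state, `g S_{i,k+1}(τ) = S₀_{i,k}`; `Λ = g e^{T}`, `g > 0`, `T > 0`,
`τ = t⋆(1 - e^{-T})`, `1 + ε₀ > 0`; shell-vector bounds `‖x_{-j}‖ ≤ M_j` on `[0, τ]` with
`Σ_j e^{-jT} g^{-j} M_j < ∞`, `M_n ≤ P gⁿ`. Then `α` carries an admissible one-profile DSS wave with delay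
`T`, non-trivial if the start shell `0` is non-zero somewhere on `[0, τ)`.
[cite: Tao2016AveragedNS, §4 Lemma 4.1, §5.3–§6; cell vocabulary (`PseudoFlowOn`, `IsDSSWave`), harvest/h2-tao-ladder rung1/STAGE2-LEMMA.md] -/
theorem isDSSWave_of_pseudoFlowOnDatum {ε₀ τ κ₂ g T tstar P : ℝ} {M : ℤ → ℝ}
    {α : Fin m → Fin m → Fin m → ℤ × ℤ × ℤ → ℝ} {S₀ F₀ B₀ : Fin m → ℤ → ℝ}
    {S F : Fin m → ℤ → ℝ → ℝ} (h : PseudoFlowOn τ ε₀ α 0 κ₂ S₀ F₀ B₀ S F)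
    (hε : 0 < 1 + ε₀) (hg : 0 < g) (hT : 0 < T) (hlam : bigLam ε₀ = g * Real.exp T) (hτ : 0 < τ)
    (htstar : τ = tstar * (1 - Real.exp (-T)))
    (hshift : ∀ (i : Fin m) (k : ℤ), g * S i (k + 1) τ = S₀ i k)
    (hM : ∀ (j : ℤ) (s : ℝ), s ∈ Icc 0 τ → ‖shellVec S (-j) s‖ ≤ M j)
    (hsum : Summable fun j : ℤ => Real.exp (-((j : ℝ) * T)) * ((g ^ j)⁻¹ * M j))
    (hP : ∀ n : ℕ, M n ≤ P * g ^ n) :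
    ∃ Φ : Unit → ℝ → Em m, IsDSSWave ε₀ α (Equiv.refl Unit) T Φ ∧
      ((∃ s ∈ Ico 0 τ, ∃ i, S i 0 s ≠ 0) → ∃ x, Φ () x ≠ 0) :=
  isDSSWave_of_quadTermDatum hε hg hT hlam hτ htstar
    (fun i k _ hs => hasDerivWithinAt_quadTerm_of_pseudoFlowOn h i k hs)
    (fun i k => by rw [hshift i k, h.init_S i k]) hM hsum hP

/-- **… (S₁)-surviving and non-trivial when `1 < g² ≤ 1 + ε₀` and the start shell is non-zero** — the
kind of object `NoSurvivingDSSOne` says does not exist below `ε_s(R)` for `R`-comparable `α`.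
[cite: Tao2016AveragedNS, §4 (the viscous equation before Thm. 4.2), §5.3–§6; cell vocabulary (`IsDSSWave`, `Surviving`)] -/
theorem exists_surviving_dssWave_of_pseudoFlowOnDatum {ε₀ τ κ₂ g T tstar P : ℝ} {M : ℤ → ℝ}
    {α : Fin m → Fin m → Fin m → ℤ × ℤ × ℤ → ℝ} {S₀ F₀ B₀ : Fin m → ℤ → ℝ}
    {S F : Fin m → ℤ → ℝ → ℝ} (h : PseudoFlowOn τ ε₀ α 0 κ₂ S₀ F₀ B₀ S F)
    (hε : 0 < 1 + ε₀) (hg : 0 < g) (hT : 0 < T) (hlam : bigLam ε₀ = g * Real.exp T) (hτ : 0 < τ)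
    (htstar : τ = tstar * (1 - Real.exp (-T)))
    (hshift : ∀ (i : Fin m) (k : ℤ), g * S i (k + 1) τ = S₀ i k)
    (hM : ∀ (j : ℤ) (s : ℝ), s ∈ Icc 0 τ → ‖shellVec S (-j) s‖ ≤ M j)
    (hsum : Summable fun j : ℤ => Real.exp (-((j : ℝ) * T)) * ((g ^ j)⁻¹ * M j))
    (hP : ∀ n : ℕ, M n ≤ P * g ^ n)
    (hg1 : 1 < g ^ 2) (hg2 : g ^ 2 ≤ 1 + ε₀) (hne : ∃ s ∈ Ico 0 τ, ∃ i, S i 0 s ≠ 0) :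
    ∃ Φ : Unit → ℝ → Em m, IsDSSWave ε₀ α (Equiv.refl Unit) T Φ ∧ Surviving 1 ε₀ T ∧
      ∃ x, Φ () x ≠ 0 := by
  obtain ⟨Φ, hΦ, hnt⟩ := isDSSWave_of_pseudoFlowOnDatum h hε hg hT hlam hτ htstar hshift hM hsum hP
  exact ⟨Φ, hΦ, (surviving_one_iff_of_bigLam_eq hε hg hlam).2 ⟨hg1, hg2⟩, hnt hne⟩

end DSSOneShift

end Summit.NavierStokesRegularity.NavierStokesRegularity.Theorems
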